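/-
Copyright: the b2b-balaban T⁴-continuum CRUX team, row NE7b OWNER lineage `t4-ne7b-p1` (gen 130). Project licence.
-/
import Summits.QuantumFields.BalabanUV.T4Continuum.Spine.NE7b.SupEffectiveActionGradientSmall

/-!
# SINGLE-SITE GAUSSIAN MOMENTS OF THE TILTED LAW ARE `O(1)`, UNIFORMLY IN THE VOLUME: for the small-field step on a region `S` (external
# field `ψ₀` small on the cells of `S`) and EVERY site `y` of `S`, with `ν = e^{−V(ψ₀,·)}N(0,Γ)∕Z`,
#   `⟨e^{δ₀(ω_y+ψ₀,y)²}⟩_ν ≤ exp(2·(Δ+1)·2e·ε̃_ΨA_τ^v)`,   `ε̃ = max(e^{v(c₃h³+δ₀h²)}−1, 2e^{−(κ∕2−κ₀−δ₀)h²})`, `2(κ₀+δ₀) ≤ κ`,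
# hence `⟨φ(ω_y+ψ₀,y)⟩_ν ≤ a·exp(…)` for any `0 ≤ φ ≤ a·e^{δ₀t²}`, e.g. `⟨|ω_y+ψ₀,y|³⟩_ν ≤ (1+2δ₀⁻²)·exp(…)` — the ONE-SITE
# PERTURBATION `w_y ↦ w_y − δ₀t²` of (314) stays in the regulated class, so (315)'s free-energy locality prices the exponential moment by
# `O(ε̃)` with NO volume factor (row NE7b, node U5c; (314)∕(315) BY NAME; [folklore])

Cell `pub-balaban`, sub-cell `t4`, spine estimate NE7b (`T4WeightBudget.RelWeightBound`; the cell's OWN estimate — NOT PRINTED in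
[Bałaban 1983–89], NOT PROVED).  Crux-route work under `Spine/NE7b/` by the row OWNER (`t4-ne7b-p1` gen 130, file (323)) under FREEZE
(0)'s crux-prover clause, on § [NE7bP1-G129-HANDOFF] NEXT (ii) (third-order re-entry: every volume-uniform bound on the tilted cumulants
of `w', w'', w'''` at single sites runs through single-site moments of `ν`); NOTHING of Bałaban's is named as a Lean object, valued or
asserted; no `T4Continuum/Support` leaf typed; no `def`, no notation; zero `sorry`.  Imports (BY NAME): the OWNER's (315)
`…SupEffectiveActionGradientSmall` (`abs_log_perturbed_sub_le`), (314) (`oneSite_measurable`, `oneSite_stable`, `oneSite_cellSum`), (313)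
(`mul_opBound_le_of_le`), (306) (`measurable_cellSum`, `cellSum_eq_sum_biUnion`), (297) (`integrable_exp_neg`); Mathlib's `Real.add_one_le_exp`,
`Real.quadratic_le_exp_of_nonneg`, `integral_mono_of_nonneg`, `Real.exp_log`, `Real.log_div`.

WHY (located).  (321) bounded the variance of the gradient by letters; the third-order half of the re-entry ((322) typed the second) and
the decay estimates of the successor manipulate tilted expectations of products of `w'_x, w''_x, w'''_x` at one, two or three sites —
by Hölder these reduce to SINGLE-SITE moments `⟨|ω_y+ψ₀,y|^k⟩_ν`.  Their volume-uniform control is exactly (315)'s mechanism with the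
quadratic one-site perturbation `δ₀t²` in place of `s·w'_y`: the perturbed family is regulated with `ε̃`, the two free energies differ by
`≤ 2(Δ+1)2eε̃_ΨA^v`, and the ratio of partition functions IS the exponential moment.

WHAT IS PROVED ([folklore]; `μ = N(0,Γ)` of range `ρ`, `Γ ⪯ γ_op·1`, diagonal `≤ γ`; disjoint cells of `≤ v` sites; `R` symmetric covering
`ρ`-closeness with `≤ Δ` neighbours; measurable `w` with `−κ₀t² ≤ w`, `|w| ≤ c₃|t|³` on `|t| ≤ h`; `0 ≤ δ₀`, `2(κ₀+δ₀) ≤ κ`, `κ(1+τ)γ_op ≤ θ < 1`;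
`ψ₀` small on the cells of `S`; `y ∈ cell p₀`, `p₀ ∈ S`; KP smallness `e·ε̃_ΨA^v(Δ+1)² ≤ ½`):
* §1 pointwise: `sq_le_inv_mul_exp_sq` (`t² ≤ δ⁻¹e^{δt²}`), `abs_cube_le_mul_exp_sq` (`|t|³ ≤ (1+2(δ²)⁻¹)e^{δt²}`);
* §2 **`tilted_expSq_le`** (`Z⁻¹∫e^{−V}e^{δ₀(ω_y+ψ₀,y)²}dμ ≤ exp(2·(Δ+1)·2e·ε̃_ΨA^v)`), `integrable_exp_neg_mul_expSq`;
* §3 **`tilted_mean_le_of_le_mul_exp_sq`** (any `φ` with `0 ≤ φ(t) ≤ a·e^{δ₀t²}` ⟹ `Z⁻¹∫e^{−V}φ(ω_y+ψ₀,y)dμ ≤ a·exp(…)`), THE END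
  **`tilted_abs_cube_le`** (`Z⁻¹∫e^{−V}|ω_y+ψ₀,y|³dμ ≤ (1+2(δ₀²)⁻¹)·exp(2·(Δ+1)·2e·ε̃_ΨA^v)`, `δ₀ > 0`); §4 toy.

HONEST (what this is NOT).  Single-site moments only (products over several sites follow by Hölder, not typed here); the small-field step
(`ψ₀` small on the cells of `S`) — on large-field cells no smallness is available and the a-priori bounds (297) apply instead; scalar
skeleton ((A3), NC-NE7b-α UNRULED); nothing of Bałaban's asserted.  BY-NAME EFFECT ON THE WALL: NONE.  NE7b NOT PRINTED ∕ NOT PROVED; spine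
PROVED 0∕9; rung (B)+1 — the programme's measures remain FINITE-torus statements; NOT the mass gap, NOT Clay.  HONEST DEPENDENCY: continuum
YM on T⁴ ⇐ BetaPertH ∧ nine spine estimates (0∕9 proved); BetaPertH ⇐ (D1) ∧ (D4) ∧ CAP+tail; G-an2-4 gates asym, D1 and NE2∕3∕4.
-/

set_option autoImplicit false

noncomputable section

namespace Summit.QuantumFields.BalabanUV.T4Continuum.NE7b.SupTiltedSingleSiteMoments

open MeasureTheory ProbabilityTheory Finset Real
open scoped BigOperators
open Literature.Analysis.Matrix (HasFiniteRange)
open SupEffectiveActionGradientSmall (abs_log_perturbed_sub_le)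
open SupOneSitePerturbation (oneSite_measurable oneSite_stable oneSite_cellSum)
open SupEffectiveActionDerivative (mul_opBound_le_of_le)
open SupSmallFieldGasReal (measurable_cellSum cellSum_eq_sum_biUnion)
open SupFluctuationAPriori (integrable_exp_neg)

variable {ι : Type} [Fintype ι] [DecidableEq ι] {V : Type*} [DecidableEq V]

/-! ## §1. Pointwise: powers under one Gaussian factor -/

/-- `0 < δ ⟹ t² ≤ δ⁻¹·e^{δt²}` (`1 + x ≤ eˣ`). [folklore] -/
theorem sq_le_inv_mul_exp_sq {δ : ℝ} (hδ : 0 < δ) (t : ℝ) : t ^ 2 ≤ δ⁻¹ * exp (δ * t ^ 2) := by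
  rw [le_inv_mul_iff₀ hδ]
  linarith [add_one_le_exp (δ * t ^ 2)]

/-- `0 < δ ⟹ |t|³ ≤ (1 + 2(δ²)⁻¹)·e^{δt²}` (`|t|³ ≤ 1 + t⁴` and `½x² ≤ eˣ` at `x = δt²`). [folklore] -/
theorem abs_cube_le_mul_exp_sq {δ : ℝ} (hδ : 0 < δ) (t : ℝ) : |t| ^ 3 ≤ (1 + 2 * (δ ^ 2)⁻¹) * exp (δ * t ^ 2) := by
  have h1 : 1 ≤ exp (δ * t ^ 2) := one_le_exp (by positivity)
  have h4 : t ^ 4 ≤ 2 * (δ ^ 2)⁻¹ * exp (δ * t ^ 2) := by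
    have hq := Real.quadratic_le_exp_of_nonneg (by positivity : 0 ≤ δ * t ^ 2)
    have h0 : 0 ≤ δ * t ^ 2 := by positivity
    rw [mul_comm 2, mul_assoc, le_inv_mul_iff₀ (by positivity)]
    nlinarith
  have h3 : |t| ^ 3 ≤ 1 + t ^ 4 := by
    have ht2 : |t| ^ 2 = t ^ 2 := sq_abs t
    rcases le_or_gt (|t|) 1 with h | h
    · have : |t| ^ 3 ≤ 1 := pow_le_one₀ (abs_nonneg t) h
      nlinarith [sq_nonneg (t ^ 2)]
    · have : |t| ^ 3 ≤ |t| ^ 4 := pow_le_pow_right₀ h.le (by norm_num)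
      have e4 : |t| ^ 4 = t ^ 4 := Even.pow_abs ⟨2, rfl⟩ t
      linarith
  nlinarith

/-! ## §2. The Gaussian exponential moment of one site under the tilted law -/

section Main

variable {Γ : Matrix ι ι ℝ} {γop γ : ℝ} {dι : ι → ι → ℕ} {ρ : ℕ} {cell : V → Finset ι} {v : ℕ} {R : V → V → Prop}
  [DecidableRel R] [Std.Symm R] {nbr : V → Finset V} {Δ : ℕ} {w : ι → ℝ → ℝ} {κ₀ δ₀ c₃ h κ τ θ Ψ : ℝ}

omit [DecidableRel R] [Std.Symm R] in
/-- **`e^{−V}·e^{δ₀(ω_y+ψ₀,y)²}` is integrable**: it is the road integrand of the one-site perturbed family `w − δ₀t²·1_y`, stable with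
`κ₀ + δ₀` (`2(κ₀+δ₀)(1+τ)γ_op ≤ θ < 1`). [folklore] -/
theorem integrable_exp_neg_mul_expSq (hΓ : Γ.PosSemidef) (hΓop : (γop • (1 : Matrix ι ι ℝ) - Γ).PosSemidef)
    (hdisj : ∀ p q, p ≠ q → Disjoint (cell p) (cell q)) (hw : ∀ x, Measurable (w x)) (hκ₀ : 0 ≤ κ₀) (hδ₀ : 0 ≤ δ₀)
    (hstab : ∀ x, ∀ t : ℝ, -(κ₀ * t ^ 2) ≤ w x t) (hτ : 0 < τ) (hθ1 : θ < 1) (hκθ₀ : 2 * (κ₀ + δ₀) * (1 + τ) * γop ≤ θ) (S : Finset V)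
    (ψ₀ : EuclideanSpace ℝ ι) {p₀ : V} (hp₀ : p₀ ∈ S) {y : ι} (hy : y ∈ cell p₀) :
    Integrable (fun ω : EuclideanSpace ℝ ι => exp (-(∑ p ∈ S, ∑ x ∈ cell p, w x (ω x + ψ₀ x))) * exp (δ₀ * (ω y + ψ₀ y) ^ 2))
      (multivariateGaussian 0 Γ) := by
  have hstab1 : ∀ x, ∀ t : ℝ, -((κ₀ + δ₀) * t ^ 2) ≤ w x t - 1 * (if x = y then δ₀ * t ^ 2 else 0) := fun x t => by
    have h1 := oneSite_stable w (fun _ t => δ₀ * t ^ 2) y 1 hstab (fun x t => by rw [abs_of_nonneg (by positivity)]) x t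
    rw [abs_one] at h1
    linarith
  have hint := integrable_exp_neg hΓ hΓop (S.biUnion cell) (fun x t => w x t - 1 * (if x = y then δ₀ * t ^ 2 else 0))
    (fun x => oneSite_measurable w (fun _ t => δ₀ * t ^ 2) y 1 hw (fun _ => (measurable_id.pow_const 2).const_mul δ₀) x)
    (by linarith) hτ hθ1 hκθ₀ hstab1 (fun x => ψ₀ x)
  refine hint.congr (ae_of_all _ fun ω => ?_)
  simp only
  rw [← cellSum_eq_sum_biUnion cell hdisj S, oneSite_cellSum w (fun _ t => δ₀ * t ^ 2) y 1 cell hdisj S hp₀ hy (fun x => ω x)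
    (fun x => ψ₀ x), ← exp_add]
  congr 1
  ring

/-- **THE GAUSSIAN EXPONENTIAL MOMENT OF ONE SITE UNDER THE TILTED LAW IS `O(1)` UNIFORMLY IN THE VOLUME.**  `Γ ⪰ 0` of range `ρ`,
`Γ ⪯ γ_op·1`, diagonal `≤ γ` (`γ ≥ 0`); disjoint cells of `≤ v` sites; `R` symmetric covering `ρ`-closeness with `≤ Δ` neighbours; measurable
`w` with `−κ₀t² ≤ w`, `|w| ≤ c₃|t|³` on `|t| ≤ h`; `0 ≤ δ₀`, `2(κ₀+δ₀) ≤ κ`, `κ(1+τ)γ_op ≤ θ < 1`; `ψ₀` small on the cells of `S`;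
`y ∈ cell p₀`, `p₀ ∈ S`; `e·ε̃_ΨA_τ^v(Δ+1)² ≤ ½` with `ε̃ = max(e^{v(c₃h³+δ₀h²)}−1, 2e^{−(κ∕2−(κ₀+δ₀))h²})` ⟹
`(∫e^{−Σ_{p∈S}Σ_{cell p}w(ω+ψ₀)}dN(0,Γ))⁻¹·∫e^{−Σ_{p∈S}Σ_{cell p}w(ω+ψ₀)}e^{δ₀(ω_y+ψ₀,y)²}dN(0,Γ) ≤ exp(2·(Δ+1)·2e·ε̃_ΨA_τ^v)`. [folklore] -/
theorem tilted_expSq_le (hΓ : Γ.PosSemidef) (hΓop : (γop • (1 : Matrix ι ι ℝ) - Γ).PosSemidef) (hdiag : ∀ i, Γ i i ≤ γ)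
    (hγ : 0 ≤ γ) (hfr : HasFiniteRange dι ρ Γ) (hdisj : ∀ p q, p ≠ q → Disjoint (cell p) (cell q)) (hv : ∀ p, (cell p).card ≤ v)
    (hR : ∀ (p p' : V) (x y : ι), x ∈ cell p → y ∈ cell p' → dι x y ≤ ρ → p = p' ∨ R p p')
    (hΔ : ∀ x, (nbr x).card ≤ Δ) (hnbr : ∀ x y, R x y → y ∈ nbr x) (hw : ∀ x, Measurable (w x))
    (hκ₀ : 0 ≤ κ₀) (hδ₀ : 0 ≤ δ₀) (hc₃ : 0 ≤ c₃) (hh : 0 ≤ h) (hstab : ∀ x, ∀ t : ℝ, -(κ₀ * t ^ 2) ≤ w x t)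
    (hcub : ∀ x, ∀ t : ℝ, |t| ≤ h → |w x t| ≤ c₃ * |t| ^ 3) (hκ : 2 * (κ₀ + δ₀) ≤ κ)
    (hτ : 0 < τ) (hθ0 : 0 < θ) (hθ1 : θ < 1) (hκθ : κ * (1 + τ) * γop ≤ θ) (S : Finset V) (ψ₀ : EuclideanSpace ℝ ι)
    (hψ : ∀ p ∈ S, ∑ x ∈ cell p, ψ₀ x ^ 2 ≤ Ψ ^ 2) {p₀ : V} (hp₀ : p₀ ∈ S) {y : ι} (hy : y ∈ cell p₀)
    (hsmall : Real.exp 1 * (((max (exp (v * (c₃ * h ^ 3 + δ₀ * h ^ 2)) - 1) (2 * exp (-((κ / 2 - (κ₀ + δ₀)) * h ^ 2)))) *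
      exp (κ * (1 + τ⁻¹) * Ψ ^ 2 / 2)) * ((1 - θ) ^ (-(κ * (1 + τ) * γ / (2 * θ)))) ^ v) * ((Δ : ℝ) + 1) ^ 2 ≤ 1 / 2) :
    (∫ ω : EuclideanSpace ℝ ι, exp (-(∑ p ∈ S, ∑ x ∈ cell p, w x (ω x + ψ₀ x))) ∂(multivariateGaussian 0 Γ))⁻¹ *
        ∫ ω : EuclideanSpace ℝ ι, exp (-(∑ p ∈ S, ∑ x ∈ cell p, w x (ω x + ψ₀ x))) * exp (δ₀ * (ω y + ψ₀ y) ^ 2)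
          ∂(multivariateGaussian 0 Γ) ≤
      exp (2 * ((1 : ℝ) * ((Δ : ℝ) + 1) * (2 * (Real.exp 1 * (((max (exp (v * (c₃ * h ^ 3 + δ₀ * h ^ 2)) - 1)
        (2 * exp (-((κ / 2 - (κ₀ + δ₀)) * h ^ 2)))) * exp (κ * (1 + τ⁻¹) * Ψ ^ 2 / 2)) *
        ((1 - θ) ^ (-(κ * (1 + τ) * γ / (2 * θ)))) ^ v))))) := by
  set μ := multivariateGaussian 0 Γ with hμ
  -- the free-energy difference of the perturbed family `w − δ₀t²·1_y` (as `w − 1·1_y·w'` with `w'(t) = δ₀t²`, `c₂ = δ₀`)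
  have hs1 : |(1 : ℝ)| ≤ 1 := by rw [abs_one]
  have hlog := abs_log_perturbed_sub_le (w' := fun _ t => δ₀ * t ^ 2) hΓ hΓop hdiag hγ hfr hdisj hv hR hΔ hnbr hw
    (fun _ => (measurable_id.pow_const 2).const_mul δ₀) hκ₀ hδ₀ hc₃ hh hstab hcub
    (fun x t => by rw [abs_of_nonneg (by positivity : (0 : ℝ) ≤ δ₀ * t ^ 2)]) hκ hτ hθ0 hθ1 hκθ S ψ₀ hψ hy hs1 hsmall
  -- identify the perturbed partition function with the exponential-moment numerator
  have heq : ∫ ω : EuclideanSpace ℝ ι, exp (-(∑ p ∈ S, ∑ x ∈ cell p,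
      (w x (ω x + ψ₀ x) - 1 * (if x = y then δ₀ * (ω x + ψ₀ x) ^ 2 else 0)))) ∂μ =
      ∫ ω : EuclideanSpace ℝ ι, exp (-(∑ p ∈ S, ∑ x ∈ cell p, w x (ω x + ψ₀ x))) * exp (δ₀ * (ω y + ψ₀ y) ^ 2) ∂μ :=
    integral_congr_ae (ae_of_all _ fun ω => by
      simp only
      rw [oneSite_cellSum w (fun _ t => δ₀ * t ^ 2) y 1 cell hdisj S hp₀ hy (fun x => ω x) (fun x => ψ₀ x), ← exp_add]
      congr 1
      ring)
  rw [heq] at hlog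
  -- positivity of both partition functions
  have hκθ₀ : 2 * κ₀ * (1 + τ) * γop ≤ θ := by
    have := mul_opBound_le_of_le (a := 2 * κ₀ * (1 + τ)) (b := κ * (1 + τ)) (by positivity)
      (mul_le_mul_of_nonneg_right (by linarith) (by linarith)) hθ0.le (by simpa [mul_assoc] using hκθ)
    simpa [mul_assoc] using this
  have hκθ₁ : 2 * (κ₀ + δ₀) * (1 + τ) * γop ≤ θ := by
    have := mul_opBound_le_of_le (a := 2 * (κ₀ + δ₀) * (1 + τ)) (b := κ * (1 + τ)) (by positivity)
      (mul_le_mul_of_nonneg_right hκ (by linarith)) hθ0.le (by simpa [mul_assoc] using hκθ)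
    simpa [mul_assoc] using this
  have hU : Integrable (fun ω : EuclideanSpace ℝ ι => exp (-(∑ p ∈ S, ∑ x ∈ cell p, w x (ω x + ψ₀ x)))) μ := by
    have h := integrable_exp_neg hΓ hΓop (S.biUnion cell) w hw hκ₀ hτ hθ1 hκθ₀ hstab (fun x => ψ₀ x)
    refine h.congr (ae_of_all _ fun ω => ?_)
    simp only
    rw [cellSum_eq_sum_biUnion cell hdisj S]
  have hZ : 0 < ∫ ω : EuclideanSpace ℝ ι, exp (-(∑ p ∈ S, ∑ x ∈ cell p, w x (ω x + ψ₀ x))) ∂μ := integral_exp_pos hU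
  have hZ' : 0 < ∫ ω : EuclideanSpace ℝ ι, exp (-(∑ p ∈ S, ∑ x ∈ cell p, w x (ω x + ψ₀ x))) * exp (δ₀ * (ω y + ψ₀ y) ^ 2) ∂μ := by
    have hI := integrable_exp_neg_mul_expSq hΓ hΓop hdisj hw hκ₀ hδ₀ hstab hτ hθ1 hκθ₁ S ψ₀ hp₀ hy
    have hI' : Integrable (fun ω : EuclideanSpace ℝ ι => exp (-(∑ p ∈ S, ∑ x ∈ cell p, w x (ω x + ψ₀ x)) + δ₀ * (ω y + ψ₀ y) ^ 2)) μ :=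
      hI.congr (ae_of_all _ fun ω => by simp only [exp_add])
    have h := integral_exp_pos hI'
    refine h.trans_le (le_of_eq (integral_congr_ae (ae_of_all _ fun ω => ?_)))
    simp only [exp_add]
  -- the ratio is the exponential of the free-energy difference
  rw [inv_mul_eq_div, ← exp_log (div_pos hZ' hZ), log_div hZ'.ne' hZ.ne']
  exact exp_le_exp.2 ((le_abs_self _).trans hlog)

/-! ## §3. Single-site moments dominated by the Gaussian one -/

/-- **SINGLE-SITE MOMENTS UNDER THE TILTED LAW**: under the hypotheses of `tilted_expSq_le`, for every `φ` with
`0 ≤ φ(t) ≤ a·e^{δ₀t²}`: `Z⁻¹·∫e^{−V}φ(ω_y+ψ₀,y)dμ ≤ a·exp(2·(Δ+1)·2e·ε̃_ΨA_τ^v)`. [folklore] -/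
theorem tilted_mean_le_of_le_mul_exp_sq (hΓ : Γ.PosSemidef) (hΓop : (γop • (1 : Matrix ι ι ℝ) - Γ).PosSemidef) (hdiag : ∀ i, Γ i i ≤ γ)
    (hγ : 0 ≤ γ) (hfr : HasFiniteRange dι ρ Γ) (hdisj : ∀ p q, p ≠ q → Disjoint (cell p) (cell q)) (hv : ∀ p, (cell p).card ≤ v)
    (hR : ∀ (p p' : V) (x y : ι), x ∈ cell p → y ∈ cell p' → dι x y ≤ ρ → p = p' ∨ R p p')
    (hΔ : ∀ x, (nbr x).card ≤ Δ) (hnbr : ∀ x y, R x y → y ∈ nbr x) (hw : ∀ x, Measurable (w x))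
    (hκ₀ : 0 ≤ κ₀) (hδ₀ : 0 ≤ δ₀) (hc₃ : 0 ≤ c₃) (hh : 0 ≤ h) (hstab : ∀ x, ∀ t : ℝ, -(κ₀ * t ^ 2) ≤ w x t)
    (hcub : ∀ x, ∀ t : ℝ, |t| ≤ h → |w x t| ≤ c₃ * |t| ^ 3) (hκ : 2 * (κ₀ + δ₀) ≤ κ)
    (hτ : 0 < τ) (hθ0 : 0 < θ) (hθ1 : θ < 1) (hκθ : κ * (1 + τ) * γop ≤ θ) (S : Finset V) (ψ₀ : EuclideanSpace ℝ ι)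
    (hψ : ∀ p ∈ S, ∑ x ∈ cell p, ψ₀ x ^ 2 ≤ Ψ ^ 2) {p₀ : V} (hp₀ : p₀ ∈ S) {y : ι} (hy : y ∈ cell p₀)
    (hsmall : Real.exp 1 * (((max (exp (v * (c₃ * h ^ 3 + δ₀ * h ^ 2)) - 1) (2 * exp (-((κ / 2 - (κ₀ + δ₀)) * h ^ 2)))) *
      exp (κ * (1 + τ⁻¹) * Ψ ^ 2 / 2)) * ((1 - θ) ^ (-(κ * (1 + τ) * γ / (2 * θ)))) ^ v) * ((Δ : ℝ) + 1) ^ 2 ≤ 1 / 2)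
    {φ : ℝ → ℝ} {a : ℝ} (hφ0 : ∀ t, 0 ≤ φ t) (hφ : ∀ t, φ t ≤ a * exp (δ₀ * t ^ 2)) :
    (∫ ω : EuclideanSpace ℝ ι, exp (-(∑ p ∈ S, ∑ x ∈ cell p, w x (ω x + ψ₀ x))) ∂(multivariateGaussian 0 Γ))⁻¹ *
        ∫ ω : EuclideanSpace ℝ ι, exp (-(∑ p ∈ S, ∑ x ∈ cell p, w x (ω x + ψ₀ x))) * φ (ω y + ψ₀ y) ∂(multivariateGaussian 0 Γ) ≤
      a * exp (2 * ((1 : ℝ) * ((Δ : ℝ) + 1) * (2 * (Real.exp 1 * (((max (exp (v * (c₃ * h ^ 3 + δ₀ * h ^ 2)) - 1)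
        (2 * exp (-((κ / 2 - (κ₀ + δ₀)) * h ^ 2)))) * exp (κ * (1 + τ⁻¹) * Ψ ^ 2 / 2)) *
        ((1 - θ) ^ (-(κ * (1 + τ) * γ / (2 * θ)))) ^ v))))) := by
  set μ := multivariateGaussian 0 Γ with hμ
  have hmain := tilted_expSq_le hΓ hΓop hdiag hγ hfr hdisj hv hR hΔ hnbr hw hκ₀ hδ₀ hc₃ hh hstab hcub hκ hτ hθ0 hθ1 hκθ S ψ₀ hψ hp₀
    hy hsmall
  have hκθ₀ : 2 * κ₀ * (1 + τ) * γop ≤ θ := by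
    have := mul_opBound_le_of_le (a := 2 * κ₀ * (1 + τ)) (b := κ * (1 + τ)) (by positivity)
      (mul_le_mul_of_nonneg_right (by linarith) (by linarith)) hθ0.le (by simpa [mul_assoc] using hκθ)
    simpa [mul_assoc] using this
  have hκθ₁ : 2 * (κ₀ + δ₀) * (1 + τ) * γop ≤ θ := by
    have := mul_opBound_le_of_le (a := 2 * (κ₀ + δ₀) * (1 + τ)) (b := κ * (1 + τ)) (by positivity)
      (mul_le_mul_of_nonneg_right hκ (by linarith)) hθ0.le (by simpa [mul_assoc] using hκθ)
    simpa [mul_assoc] using this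
  have hU : Integrable (fun ω : EuclideanSpace ℝ ι => exp (-(∑ p ∈ S, ∑ x ∈ cell p, w x (ω x + ψ₀ x)))) μ := by
    have h := integrable_exp_neg hΓ hΓop (S.biUnion cell) w hw hκ₀ hτ hθ1 hκθ₀ hstab (fun x => ψ₀ x)
    refine h.congr (ae_of_all _ fun ω => ?_)
    simp only
    rw [cellSum_eq_sum_biUnion cell hdisj S]
  have hZ : 0 < ∫ ω : EuclideanSpace ℝ ι, exp (-(∑ p ∈ S, ∑ x ∈ cell p, w x (ω x + ψ₀ x))) ∂μ := integral_exp_pos hU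
  have hI := integrable_exp_neg_mul_expSq hΓ hΓop hdisj hw hκ₀ hδ₀ hstab hτ hθ1 hκθ₁ S ψ₀ hp₀ hy
  -- pointwise domination `e^{−V}φ ≤ a·e^{−V}e^{δ₀t²}`, integrated and divided by `Z`
  have hmono : ∫ ω : EuclideanSpace ℝ ι, exp (-(∑ p ∈ S, ∑ x ∈ cell p, w x (ω x + ψ₀ x))) * φ (ω y + ψ₀ y) ∂μ ≤
      ∫ ω : EuclideanSpace ℝ ι, a * (exp (-(∑ p ∈ S, ∑ x ∈ cell p, w x (ω x + ψ₀ x))) * exp (δ₀ * (ω y + ψ₀ y) ^ 2)) ∂μ := by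
    refine integral_mono_of_nonneg (ae_of_all _ fun ω => mul_nonneg (exp_pos _).le (hφ0 _)) (hI.const_mul a)
      (ae_of_all _ fun ω => ?_)
    have h := hφ (ω y + ψ₀ y)
    have he : 0 < exp (-(∑ p ∈ S, ∑ x ∈ cell p, w x (ω x + ψ₀ x))) := exp_pos _
    nlinarith
  rw [integral_const_mul] at hmono
  calc (∫ ω : EuclideanSpace ℝ ι, exp (-(∑ p ∈ S, ∑ x ∈ cell p, w x (ω x + ψ₀ x))) ∂μ)⁻¹ *
        ∫ ω : EuclideanSpace ℝ ι, exp (-(∑ p ∈ S, ∑ x ∈ cell p, w x (ω x + ψ₀ x))) * φ (ω y + ψ₀ y) ∂μ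
      ≤ (∫ ω : EuclideanSpace ℝ ι, exp (-(∑ p ∈ S, ∑ x ∈ cell p, w x (ω x + ψ₀ x))) ∂μ)⁻¹ *
        (a * ∫ ω : EuclideanSpace ℝ ι, exp (-(∑ p ∈ S, ∑ x ∈ cell p, w x (ω x + ψ₀ x))) * exp (δ₀ * (ω y + ψ₀ y) ^ 2) ∂μ) :=
        mul_le_mul_of_nonneg_left hmono (inv_nonneg.2 hZ.le)
    _ = a * ((∫ ω : EuclideanSpace ℝ ι, exp (-(∑ p ∈ S, ∑ x ∈ cell p, w x (ω x + ψ₀ x))) ∂μ)⁻¹ *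
        ∫ ω : EuclideanSpace ℝ ι, exp (-(∑ p ∈ S, ∑ x ∈ cell p, w x (ω x + ψ₀ x))) * exp (δ₀ * (ω y + ψ₀ y) ^ 2) ∂μ) := by ring
    _ ≤ _ := by
        have ha : 0 ≤ a := by
          have h := hφ 0
          have h0 := hφ0 0
          rw [zero_pow two_ne_zero, mul_zero, exp_zero, mul_one] at h
          linarith
        exact mul_le_mul_of_nonneg_left hmain ha

/-- **THE END — THE THIRD ABSOLUTE SINGLE-SITE MOMENT OF THE TILTED LAW IS `O(1)` UNIFORMLY IN THE VOLUME**: under the hypotheses of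
`tilted_expSq_le` with `0 < δ₀`: `Z⁻¹·∫e^{−V}|ω_y+ψ₀,y|³dμ ≤ (1 + 2(δ₀²)⁻¹)·exp(2·(Δ+1)·2e·ε̃_ΨA_τ^v)`. [folklore] -/
theorem tilted_abs_cube_le (hΓ : Γ.PosSemidef) (hΓop : (γop • (1 : Matrix ι ι ℝ) - Γ).PosSemidef) (hdiag : ∀ i, Γ i i ≤ γ)
    (hγ : 0 ≤ γ) (hfr : HasFiniteRange dι ρ Γ) (hdisj : ∀ p q, p ≠ q → Disjoint (cell p) (cell q)) (hv : ∀ p, (cell p).card ≤ v)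
    (hR : ∀ (p p' : V) (x y : ι), x ∈ cell p → y ∈ cell p' → dι x y ≤ ρ → p = p' ∨ R p p')
    (hΔ : ∀ x, (nbr x).card ≤ Δ) (hnbr : ∀ x y, R x y → y ∈ nbr x) (hw : ∀ x, Measurable (w x))
    (hκ₀ : 0 ≤ κ₀) (hδ₀ : 0 < δ₀) (hc₃ : 0 ≤ c₃) (hh : 0 ≤ h) (hstab : ∀ x, ∀ t : ℝ, -(κ₀ * t ^ 2) ≤ w x t)
    (hcub : ∀ x, ∀ t : ℝ, |t| ≤ h → |w x t| ≤ c₃ * |t| ^ 3) (hκ : 2 * (κ₀ + δ₀) ≤ κ)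
    (hτ : 0 < τ) (hθ0 : 0 < θ) (hθ1 : θ < 1) (hκθ : κ * (1 + τ) * γop ≤ θ) (S : Finset V) (ψ₀ : EuclideanSpace ℝ ι)
    (hψ : ∀ p ∈ S, ∑ x ∈ cell p, ψ₀ x ^ 2 ≤ Ψ ^ 2) {p₀ : V} (hp₀ : p₀ ∈ S) {y : ι} (hy : y ∈ cell p₀)
    (hsmall : Real.exp 1 * (((max (exp (v * (c₃ * h ^ 3 + δ₀ * h ^ 2)) - 1) (2 * exp (-((κ / 2 - (κ₀ + δ₀)) * h ^ 2)))) *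
      exp (κ * (1 + τ⁻¹) * Ψ ^ 2 / 2)) * ((1 - θ) ^ (-(κ * (1 + τ) * γ / (2 * θ)))) ^ v) * ((Δ : ℝ) + 1) ^ 2 ≤ 1 / 2) :
    (∫ ω : EuclideanSpace ℝ ι, exp (-(∑ p ∈ S, ∑ x ∈ cell p, w x (ω x + ψ₀ x))) ∂(multivariateGaussian 0 Γ))⁻¹ *
        ∫ ω : EuclideanSpace ℝ ι, exp (-(∑ p ∈ S, ∑ x ∈ cell p, w x (ω x + ψ₀ x))) * |ω y + ψ₀ y| ^ 3 ∂(multivariateGaussian 0 Γ) ≤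
      (1 + 2 * (δ₀ ^ 2)⁻¹) * exp (2 * ((1 : ℝ) * ((Δ : ℝ) + 1) * (2 * (Real.exp 1 * (((max (exp (v * (c₃ * h ^ 3 + δ₀ * h ^ 2)) - 1)
        (2 * exp (-((κ / 2 - (κ₀ + δ₀)) * h ^ 2)))) * exp (κ * (1 + τ⁻¹) * Ψ ^ 2 / 2)) *
        ((1 - θ) ^ (-(κ * (1 + τ) * γ / (2 * θ)))) ^ v))))) :=
  tilted_mean_le_of_le_mul_exp_sq hΓ hΓop hdiag hγ hfr hdisj hv hR hΔ hnbr hw hκ₀ hδ₀.le hc₃ hh hstab hcub hκ hτ hθ0 hθ1 hκθ S ψ₀ hψ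
    hp₀ hy hsmall (φ := fun t => |t| ^ 3) (fun t => by positivity)
    (fun t => abs_cube_le_mul_exp_sq hδ₀ t)

end Main

/-! ## §4. Toy -/

/-- Toy (§1): at `δ = 1`, `t = 1`: `1 ≤ 3e`. -/
example : |(1 : ℝ)| ^ 3 ≤ (1 + 2 * ((1 : ℝ) ^ 2)⁻¹) * exp (1 * (1 : ℝ) ^ 2) := abs_cube_le_mul_exp_sq one_pos 1

end Summit.QuantumFields.BalabanUV.T4Continuum.NE7b.SupTiltedSingleSiteMoments
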